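import Literature.Probability.Process.ConformalTimeChangeLaw
import Literature.Probability.Process.PathSegment
import Literature.Probability.RandomPlanarGeometry.CurveMonotoneReparam
import Literature.Probability.RandomPlanarGeometry.UnbasedLoopImage
import Mathlib.MeasureTheory.Function.Jacobian
import HarnessLib

/-!
# Conformal invariance of killed planar Brownian motion, functional form

Eighth file on P. Lévy's conformal invariance of planar Brownian motion (Lawler (2005),
Thm. 2.2; used in the form of [Lawler] §2.4 / Prop. 5.5: the image under a conformal
transformation `f : D → D'` of Brownian motion killed on leaving `D` is, *modulo
reparametrisation*, Brownian motion killed on leaving `D'`, the new time being the conformal clock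
`∫ |f'(B)|²`). From the law identity `map_mkD_tcEnl_eq` (`ConformalTimeChangeLaw`) we read off,
for a bounded open `U_ℂ` with `closure U_ℂ ⊆ D`, `f` injective on `D` with `f' ≠ 0` and
`f(U_ℂ)` open, and every measurable `Ψ ≥ 0` on (curve class, time):

* `lintegral_killed_conformal_eq` —
  `E[∫₀^{ρ} Ψ([f ∘ X|[0,t]], σ_t) |f'(X_t)|² dt] = E'[∫₀^{ρ'} Ψ([B'|[0,u]], u) du]`,
  where `X = x₀ + W` is killed at the exit time `ρ` of `U = toC⁻¹ U_ℂ`, `σ_t = ∫₀ᵗ |f'(X_r)|² dr`,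
  `B' = f(x₀) + W'` is killed at the exit time `ρ'` of `f(U_ℂ)`, and `[γ]` denotes the class of a
  path modulo increasing reparametrisation (`CurveClass`): the killing is written with
  `staysIn`, the restriction with `pathSeg` (`PathSegment`), `f ∘ ·` with `Curve.imageOn`, and the
  paths with `ContinuousMap.mkD`.

Ingredients: on `{ρ < ∞}` the enlarged process stays in `f(U_ℂ)` exactly before the total clock
`S` and coincides there with the time-changed process `Ỹ` (`mem_staysIn_tcEnl_iff`); the time
substitution `u = σ_t` (Mathlib's one-dimensional change of variables
`lintegral_image_eq_lintegral_abs_deriv_mul`, the clock being `C¹` and strictly increasing); and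
`[Ỹ|[0,σ_t]] = [f ∘ X|[0,t]]` (two monotone traversals of the same arc,
`Curve.reparamDist_eq_zero_of_monotone'`).

## References

* G. F. Lawler, *Conformally Invariant Processes in the Plane*, AMS (2005), Thm. 2.2, §2.4,
  Prop. 5.5.
* J.-F. Le Gall, *Brownian Motion, Martingales, and Stochastic Calculus* (2016), Thm. 7.19.
-/

noncomputable section

open MeasureTheory ProbabilityTheory Filter Topology Set Complex Metric
open scoped NNReal ENNReal BigOperators ComplexConjugate unitInterval

namespace Literature.Probability.Process

open Literature.Probability.RandomPlanarGeometry

variable {Ω Ω' : Type*} {mΩ : MeasurableSpace Ω} {mΩ' : MeasurableSpace Ω'} {P : Measure Ω}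
  {P' : Measure Ω'} {W : ℝ≥0 → Ω → (Fin 2 → ℝ)} {W' : ℝ≥0 → Ω' → (Fin 2 → ℝ)}

/-! ### The open set `U = toC⁻¹ U_ℂ` -/

/-- `toC` is injective. [folklore] -/
theorem toC_injective : Function.Injective toC := fun v w h ↦ by
  have := congrArg ofC h; rwa [ofC_toC, ofC_toC] at this

/-- `toC` is surjective. [folklore] -/
theorem toC_surjective : Function.Surjective toC := fun z ↦ ⟨ofC z, toC_ofC z⟩

/-- The sup norm of the coordinates is at most the modulus. [folklore] -/
theorem norm_le_norm_toC (v : Fin 2 → ℝ) : ‖v‖ ≤ ‖toC v‖ := by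
  refine (pi_norm_le_iff_of_nonneg (norm_nonneg _)).2 fun i ↦ ?_
  fin_cases i
  · simpa using Complex.abs_re_le_norm (toC v)
  · simpa using Complex.abs_im_le_norm (toC v)

/-- The preimage under `toC` of a bounded set is bounded. [folklore] -/
theorem isBounded_preimage_toC {A : Set ℂ} (h : Bornology.IsBounded A) : Bornology.IsBounded (toC ⁻¹' A) := by
  obtain ⟨R, hR⟩ := h.subset_closedBall 0
  refine isBounded_iff_forall_norm_le.2 ⟨R, fun v hv ↦ (norm_le_norm_toC v).trans ?_⟩
  have := hR hv
  rwa [mem_closedBall, dist_zero_right] at this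

/-- The curve class of a continuous path on `[0,1]` (abbreviating `CurveClass.mk ∘ Curve.mk`).
[folklore] -/
theorem continuous_curveClass_mk : Continuous fun γ : C(I, ℂ) ↦ CurveClass.mk (Curve.mk γ) :=
  CurveClass.continuous_mk.comp Curve.lipschitzWith_mk.continuous

namespace IsBrownianVec

variable {x₀ : Fin 2 → ℝ} {Uc D : Set ℂ} {f : ℂ → ℂ}

/-! ### The time-changed process before the total clock -/

section Pointwise

/-- `closure (toC⁻¹ U_ℂ) ⊆ toC⁻¹ D`. [folklore] -/
theorem closure_preimage_subset_preimage (hUcD : closure Uc ⊆ D) : closure (toC ⁻¹' Uc) ⊆ toC ⁻¹' D :=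
  (continuous_toC.closure_preimage_subset Uc).trans (preimage_mono hUcD)

/-- A positive lower bound for `|f'|²` on `closure U`. [folklore] -/
theorem exists_lower_bound (hD : IsOpen D) (hf : DifferentiableOn ℂ f D) (hf' : ∀ z ∈ D, deriv f z ≠ 0)
    (hUcb : Bornology.IsBounded Uc) (hUcD : closure Uc ⊆ D) :
    ∃ m : ℝ, 0 < m ∧ ∀ y ∈ closure (toC ⁻¹' Uc), m ≤ ‖deriv f (toC y)‖ ^ 2 := by
  rcases (closure (toC ⁻¹' Uc)).eq_empty_or_nonempty with h | h
  · exact ⟨1, one_pos, fun y hy ↦ by rw [h] at hy; exact absurd hy (notMem_empty _)⟩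
  · exact exists_lower_bound_deriv_sq hD hf hf' (isBounded_preimage_toC hUcb).isCompact_closure
      (closure_preimage_subset_preimage hUcD) h

/-- Before the exit time the stopped position is in `U`. [folklore] -/
theorem confPos_mem_of_lt {ω : Ω} {t : ℝ≥0} (ht : (t : WithTop ℝ≥0) < hitTime x₀ W (toC ⁻¹' Uc)ᶜ ω) :
    confPos x₀ W (toC ⁻¹' Uc) t ω ∈ toC ⁻¹' Uc := by
  have h := notMem_of_coe_lt_hittingAfter_zero (u := fun t ω ↦ x₀ + W t ω) (s := (toC ⁻¹' Uc)ᶜ) ht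
  rw [confPos_of_le (le_of_eq (stopT_of_le ht.le).symm)]
  simpa using h

/-- **Before the total clock the time-changed process is in `f(U_ℂ)`.** [folklore] -/
theorem tcPos_mem_of_lt (hW : IsBrownianVec W P) (hD : IsOpen D) (hf : DifferentiableOn ℂ f D)
    (hf' : ∀ z ∈ D, deriv f z ≠ 0) (hUc : IsOpen Uc) (hUcb : Bornology.IsBounded Uc) (hUcD : closure Uc ⊆ D)
    (hx₀ : toC x₀ ∈ Uc) {ω : Ω} {T : ℝ≥0} (hρ : hitTime x₀ W (toC ⁻¹' Uc)ᶜ ω = T) {u : ℝ≥0}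
    (hu : (u : ℝ) < totClock x₀ W f (toC ⁻¹' Uc) ω) : tcPos x₀ W f (toC ⁻¹' Uc) u ω ∈ f '' Uc := by
  have hU : IsOpen (toC ⁻¹' Uc) := hUc.preimage continuous_toC
  have hUD := closure_preimage_subset_preimage (Uc := Uc) hUcD
  obtain ⟨m, hm0, hm⟩ := exists_lower_bound hD hf hf' hUcb hUcD
  have hlt := (hW.clockInv_lt_iff hD hf hU hUD hx₀ hm0 hm hρ u).2 (by rwa [totClock, hρ] at hu)
  obtain ⟨a, ha⟩ := WithTop.ne_top_iff_exists.1 (clockInv_ne_top (f := f) hρ u)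
  rw [← ha, untopA_coe] at hlt
  have hmem := confPos_mem_of_lt (x₀ := x₀) (W := W) (Uc := Uc) (t := a) (by rw [hρ]; exact WithTop.coe_lt_coe.2 hlt)
  refine ⟨toC (confPos x₀ W (toC ⁻¹' Uc) a ω), hmem, ?_⟩
  rw [tcPos, stoppedValue, ← ha, untopA_coe]

/-- **At and after the total clock the time-changed process sits at `f(X_ρ)`**: for `u ≥ S` the
inverse clock is the exit time. [folklore] -/
theorem tcPos_eq_of_le (hW : IsBrownianVec W P) (hD : IsOpen D) (hf : DifferentiableOn ℂ f D)
    (hf' : ∀ z ∈ D, deriv f z ≠ 0) (hUc : IsOpen Uc) (hUcb : Bornology.IsBounded Uc) (hUcD : closure Uc ⊆ D)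
    (hx₀ : toC x₀ ∈ Uc) {ω : Ω} {T : ℝ≥0} (hρ : hitTime x₀ W (toC ⁻¹' Uc)ᶜ ω = T) {u : ℝ≥0}
    (hu : totClock x₀ W f (toC ⁻¹' Uc) ω ≤ u) : tcPos x₀ W f (toC ⁻¹' Uc) u ω = f (toC (x₀ + W T ω)) := by
  have hU : IsOpen (toC ⁻¹' Uc) := hUc.preimage continuous_toC
  have hUD := closure_preimage_subset_preimage (Uc := Uc) hUcD
  obtain ⟨m, hm0, hm⟩ := exists_lower_bound hD hf hf' hUcb hUcD
  have hle := untopA_clockInv_le (f := f) hρ u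
  have hnlt : ¬ (clockInv x₀ W f (toC ⁻¹' Uc) u ω).untopA < T := fun h ↦ by
    have := (hW.clockInv_lt_iff hD hf hU hUD hx₀ hm0 hm hρ u).1 h
    rw [totClock, hρ] at hu
    exact absurd this (not_lt.2 hu)
  have heq : (clockInv x₀ W f (toC ⁻¹' Uc) u ω).untopA = T := le_antisymm hle (not_lt.1 hnlt)
  rw [tcPos, stoppedValue, heq, confPos, stopT_of_eq_coe hρ, min_self]

/-- **The value at the total clock is outside `f(U_ℂ)`** (`f` injective on `D`): `X_ρ ∉ U`.
[folklore] -/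
theorem tcPos_not_mem_of_le (hW : IsBrownianVec W P) (hD : IsOpen D) (hf : DifferentiableOn ℂ f D)
    (hf' : ∀ z ∈ D, deriv f z ≠ 0) (hfi : InjOn f D) (hUc : IsOpen Uc) (hUcb : Bornology.IsBounded Uc)
    (hUcD : closure Uc ⊆ D) (hx₀ : toC x₀ ∈ Uc) {ω : Ω} {T : ℝ≥0} (hρ : hitTime x₀ W (toC ⁻¹' Uc)ᶜ ω = T)
    {u : ℝ≥0} (hu : totClock x₀ W f (toC ⁻¹' Uc) ω ≤ u) : tcPos x₀ W f (toC ⁻¹' Uc) u ω ∉ f '' Uc := by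
  have hU : IsOpen (toC ⁻¹' Uc) := hUc.preimage continuous_toC
  rw [hW.tcPos_eq_of_le hD hf hf' hUc hUcb hUcD hx₀ hρ hu]
  rintro ⟨z, hz, hfz⟩
  have hXT : x₀ + W T ω ∈ (toC ⁻¹' Uc)ᶜ := hW.mem_of_hitTime_eq_coe hU.isClosed_compl hρ
  have hXcl : x₀ + W T ω ∈ closure (toC ⁻¹' Uc) := by
    have := hW.confPos_mem_closure hU hx₀ T ω
    rwa [confPos, stopT_of_eq_coe hρ, min_self] at this
  have hXD : toC (x₀ + W T ω) ∈ D := closure_preimage_subset_preimage (Uc := Uc) hUcD hXcl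
  have hzeq : z = toC (x₀ + W T ω) := hfi (subset_closure.trans hUcD hz) hXD hfz
  have : toC (x₀ + W T ω) ∈ Uc := hzeq ▸ hz
  exact hXT this

end Pointwise

/-! ### The enlarged process before the total clock -/

/-- Before the total clock the enlarged process is the time-changed process. [folklore] -/
theorem tcEnl_eq_tcPos_of_le (hW' : IsBrownianVec W' P') {U : Set (Fin 2 → ℝ)} {u : ℝ≥0} {p : Ω × Ω'}
    (hu : (u : ℝ) ≤ totClock x₀ W f U p.1) : tcEnl x₀ W f U W' u p = tcPos x₀ W f U u p.1 := by
  rw [tcEnl, Real.toNNReal_of_nonpos (by linarith), hW'.apply_zero, toC_zero, add_zero]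

section Enlarged

/-- **The enlarged path stays in `f(U_ℂ)` up to time `u` iff `u < S`** (finite exit time).
[folklore] -/
theorem mem_staysIn_tcEnl_iff (hW : IsBrownianVec W P) (hW' : IsBrownianVec W' P') (hD : IsOpen D)
    (hf : DifferentiableOn ℂ f D) (hf' : ∀ z ∈ D, deriv f z ≠ 0) (hfi : InjOn f D) (hUc : IsOpen Uc)
    (hUcb : Bornology.IsBounded Uc) (hUcD : closure Uc ⊆ D) (hx₀ : toC x₀ ∈ Uc)
    {p : Ω × Ω'} {T : ℝ≥0} (hρ : hitTime x₀ W (toC ⁻¹' Uc)ᶜ p.1 = T) (u : ℝ≥0) :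
    (ContinuousMap.mkD (fun u ↦ tcEnl x₀ W f (toC ⁻¹' Uc) W' u p) 0, u) ∈ staysIn (f '' Uc) ↔
      (u : ℝ) < totClock x₀ W f (toC ⁻¹' Uc) p.1 := by
  have hU : IsOpen (toC ⁻¹' Uc) := hUc.preimage continuous_toC
  have hUD := closure_preimage_subset_preimage (Uc := Uc) hUcD
  have hc : Continuous fun u ↦ tcEnl x₀ W f (toC ⁻¹' Uc) W' u p :=
    hW.continuous_tcEnl_of_ne_top hW' hD hf hf' hU (isBounded_preimage_toC hUcb).isCompact_closure hUD hx₀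
      (by rw [hρ]; exact WithTop.coe_ne_top)
  rw [mem_staysIn]
  simp only [ContinuousMap.mkD_apply_of_continuous hc]
  constructor
  · intro h
    by_contra hS
    rw [not_lt] at hS
    set r : ℝ≥0 := (totClock x₀ W f (toC ⁻¹' Uc) p.1).toNNReal with hr
    have hS0 : 0 ≤ totClock x₀ W f (toC ⁻¹' Uc) p.1 := hW.totClock_nonneg hD hf hU hUD hx₀ p.1
    have hrS : (r : ℝ) = totClock x₀ W f (toC ⁻¹' Uc) p.1 := Real.coe_toNNReal _ hS0
    have hru : r ≤ u := by rw [← NNReal.coe_le_coe, hrS]; exact hS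
    have h1 := h r hru
    rw [tcEnl_eq_tcPos_of_le hW' (le_of_eq hrS)] at h1
    exact hW.tcPos_not_mem_of_le hD hf hf' hfi hUc hUcb hUcD hx₀ hρ (le_of_eq hrS.symm) h1
  · intro h r hr
    have hr' : (r : ℝ) < totClock x₀ W f (toC ⁻¹' Uc) p.1 := lt_of_le_of_lt (NNReal.coe_le_coe.2 hr) h
    rw [tcEnl_eq_tcPos_of_le hW' hr'.le]
    exact hW.tcPos_mem_of_lt hD hf hf' hUc hUcb hUcD hx₀ hρ hr'

/-- Before the total clock the segments of the enlarged path are those of the time-changed path.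
[folklore] -/
theorem pathSeg_tcEnl_eq (hW : IsBrownianVec W P) (hW' : IsBrownianVec W' P') (hD : IsOpen D)
    (hf : DifferentiableOn ℂ f D) (hf' : ∀ z ∈ D, deriv f z ≠ 0) (hUc : IsOpen Uc)
    (hUcb : Bornology.IsBounded Uc) (hUcD : closure Uc ⊆ D) (hx₀ : toC x₀ ∈ Uc)
    {p : Ω × Ω'} (hρ : hitTime x₀ W (toC ⁻¹' Uc)ᶜ p.1 ≠ ⊤) {u : ℝ≥0}
    (hu : (u : ℝ) < totClock x₀ W f (toC ⁻¹' Uc) p.1) :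
    pathSeg (ContinuousMap.mkD (fun u ↦ tcEnl x₀ W f (toC ⁻¹' Uc) W' u p) 0) u =
      pathSeg (ContinuousMap.mkD (fun u ↦ tcPos x₀ W f (toC ⁻¹' Uc) u p.1) 0) u := by
  have hU : IsOpen (toC ⁻¹' Uc) := hUc.preimage continuous_toC
  have hUD := closure_preimage_subset_preimage (Uc := Uc) hUcD
  have hUC := (isBounded_preimage_toC hUcb).isCompact_closure
  have hc := hW.continuous_tcEnl_of_ne_top hW' hD hf hf' hU hUC hUD hx₀ (p := p) hρ
  have hc' := hW.continuous_tcPos_of_ne_top hD hf hf' hU hUC hUD hx₀ hρ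
  ext v
  simp only [pathSeg_apply, ContinuousMap.mkD_apply_of_continuous hc, ContinuousMap.mkD_apply_of_continuous hc']
  exact tcEnl_eq_tcPos_of_le hW' ((NNReal.coe_le_coe.2 (scaleI_le u v)).trans hu.le)

end Enlarged

/-! ### The original path: staying in `U_ℂ`; the clock as a `C¹` bijection; reparametrisation -/

section Original

/-- **The original path stays in `U_ℂ` up to time `t` iff `t < ρ`.** [folklore] -/
theorem mem_staysIn_path_iff (hW : IsBrownianVec W P) (hUc : IsOpen Uc) (ω : Ω) (t : ℝ≥0) :
    (ContinuousMap.mkD (fun t ↦ toC (x₀ + W t ω)) 0, t) ∈ staysIn Uc ↔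
      (t : WithTop ℝ≥0) < hitTime x₀ W (toC ⁻¹' Uc)ᶜ ω := by
  have hU : IsOpen (toC ⁻¹' Uc) := hUc.preimage continuous_toC
  have hc : Continuous fun t ↦ toC (x₀ + W t ω) := continuous_toC.comp (continuous_const.add (hW.continuous_path ω))
  rw [mem_staysIn]
  simp only [ContinuousMap.mkD_apply_of_continuous hc]
  constructor
  · intro h
    by_contra hle
    rw [not_lt] at hle
    obtain ⟨T₀, hT₀⟩ := WithTop.ne_top_iff_exists.1 (ne_top_of_le_ne_top WithTop.coe_ne_top hle)
    have hle' : T₀ ≤ t := by rw [← hT₀] at hle; exact WithTop.coe_le_coe.1 hle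
    have hmem := hW.mem_of_hitTime_eq_coe hU.isClosed_compl hT₀.symm
    exact hmem (h T₀ hle')
  · intro h r hr
    have := notMem_of_coe_lt_hittingAfter_zero (u := fun t ω ↦ x₀ + W t ω) (s := (toC ⁻¹' Uc)ᶜ)
      (lt_of_le_of_lt (WithTop.coe_le_coe.2 hr) h)
    simpa using this

/-- The clock in real time, up to the exit time, is the primitive of the clock integrand.
[folklore] -/
theorem confClock_toNNReal_eq {ω : Ω} {T : ℝ≥0} (hρ : hitTime x₀ W (toC ⁻¹' Uc)ᶜ ω = T) {t : ℝ}
    (ht : t ∈ Icc (0 : ℝ) T) :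
    confClock x₀ W f (toC ⁻¹' Uc) t.toNNReal ω = ∫ r in (0 : ℝ)..t, clockIntegrand x₀ W f (toC ⁻¹' Uc) ω r := by
  have h1 : (t.toNNReal : ℝ≥0) ≤ T := Real.toNNReal_le_iff_le_coe.2 ht.2
  rw [confClock_eq, stopT_of_eq_coe hρ, min_eq_left h1, Real.coe_toNNReal _ ht.1]

/-- On `[0, ρ]` the clock integrand is `|f'(X_t)|²`. [folklore] -/
theorem clockIntegrand_eq_of_le {ω : Ω} {T : ℝ≥0} (hρ : hitTime x₀ W (toC ⁻¹' Uc)ᶜ ω = T) {r : ℝ}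
    (hr : r ≤ T) : clockIntegrand x₀ W f (toC ⁻¹' Uc) ω r = ‖deriv f (toC (x₀ + W r.toNNReal ω))‖ ^ 2 := by
  rw [clockIntegrand_apply, confPos_of_le]
  rw [stopT_of_eq_coe hρ, min_self]
  exact Real.toNNReal_le_iff_le_coe.2 hr

/-- **The clock is a strictly increasing `C¹` bijection `(0, T) → (0, S)`** on `{ρ = T}`:
derivative, injectivity and image. [folklore] -/
theorem clock_change_of_variables (hW : IsBrownianVec W P) (hD : IsOpen D) (hf : DifferentiableOn ℂ f D)
    (hf' : ∀ z ∈ D, deriv f z ≠ 0) (hUc : IsOpen Uc) (hUcb : Bornology.IsBounded Uc)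
    (hUcD : closure Uc ⊆ D) (hx₀ : toC x₀ ∈ Uc) {ω : Ω} {T : ℝ≥0} (hρ : hitTime x₀ W (toC ⁻¹' Uc)ᶜ ω = T) :
    (∀ t ∈ Ioo (0 : ℝ) T, HasDerivWithinAt (fun t : ℝ ↦ confClock x₀ W f (toC ⁻¹' Uc) t.toNNReal ω)
        (clockIntegrand x₀ W f (toC ⁻¹' Uc) ω t) (Ioo (0 : ℝ) T) t) ∧
    InjOn (fun t : ℝ ↦ confClock x₀ W f (toC ⁻¹' Uc) t.toNNReal ω) (Ioo (0 : ℝ) T) ∧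
    (fun t : ℝ ↦ confClock x₀ W f (toC ⁻¹' Uc) t.toNNReal ω) '' Ioo (0 : ℝ) T =
      Ioo (0 : ℝ) (totClock x₀ W f (toC ⁻¹' Uc) ω) := by
  have hU : IsOpen (toC ⁻¹' Uc) := hUc.preimage continuous_toC
  have hUD := closure_preimage_subset_preimage (Uc := Uc) hUcD
  have hx₀' : x₀ ∈ toC ⁻¹' Uc := hx₀
  obtain ⟨m, hm0, hm⟩ := exists_lower_bound hD hf hf' hUcb hUcD
  have hS : totClock x₀ W f (toC ⁻¹' Uc) ω = confClock x₀ W f (toC ⁻¹' Uc) T ω := by rw [totClock, hρ]; rfl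
  -- strict monotonicity on `[0, T]` (real time)
  have hstrict : ∀ ⦃s t : ℝ⦄, s ∈ Icc (0 : ℝ) T → t ∈ Icc (0 : ℝ) T → s < t →
      confClock x₀ W f (toC ⁻¹' Uc) s.toNNReal ω < confClock x₀ W f (toC ⁻¹' Uc) t.toNNReal ω := by
    intro s t hs ht hst
    have hst' : s.toNNReal ≤ t.toNNReal := Real.toNNReal_le_toNNReal hst.le
    have hgap := hW.confClock_sub_ge hD hf hU hUD hx₀' hm ω hst'
    have hsT : (s.toNNReal : ℝ≥0) ≤ T := Real.toNNReal_le_iff_le_coe.2 hs.2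
    have htT : (t.toNNReal : ℝ≥0) ≤ T := Real.toNNReal_le_iff_le_coe.2 ht.2
    rw [stopT_of_eq_coe hρ, stopT_of_eq_coe hρ, min_eq_left hsT, min_eq_left htT,
      Real.coe_toNNReal _ hs.1, Real.coe_toNNReal _ ht.1] at hgap
    have : 0 < m * (t - s) := mul_pos hm0 (by linarith)
    linarith
  refine ⟨fun t ht ↦ ?_, fun s hs t ht hst ↦ ?_, ?_⟩
  · -- derivative: the clock agrees with the primitive of the continuous clock integrand on `(0, T)`
    have hc := hW.continuous_clockIntegrand hD hf hU hUD hx₀' ω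
    have hF : HasDerivAt (fun t : ℝ ↦ ∫ r in (0 : ℝ)..t, clockIntegrand x₀ W f (toC ⁻¹' Uc) ω r)
        (clockIntegrand x₀ W f (toC ⁻¹' Uc) ω t) t := (hc.integral_hasStrictDerivAt 0 t).hasDerivAt
    refine (hF.hasDerivWithinAt (s := Ioo (0 : ℝ) T)).congr (fun s hs ↦ ?_) ?_
    · exact confClock_toNNReal_eq (f := f) hρ (Ioo_subset_Icc_self hs)
    · exact confClock_toNNReal_eq (f := f) hρ (Ioo_subset_Icc_self ht)
  · -- injectivity
    rcases lt_trichotomy s t with h | h | h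
    · exact absurd hst (ne_of_lt (hstrict (Ioo_subset_Icc_self hs) (Ioo_subset_Icc_self ht) h))
    · exact h
    · exact absurd hst (ne_of_gt (hstrict (Ioo_subset_Icc_self ht) (Ioo_subset_Icc_self hs) h))
  · -- image
    have h0 : confClock x₀ W f (toC ⁻¹' Uc) (0 : ℝ).toNNReal ω = 0 := by rw [Real.toNNReal_zero, confClock_zero]
    have hT : confClock x₀ W f (toC ⁻¹' Uc) (T : ℝ).toNNReal ω = totClock x₀ W f (toC ⁻¹' Uc) ω := by
      rw [Real.toNNReal_coe, hS]
    apply Subset.antisymm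
    · rintro _ ⟨t, ht, rfl⟩
      refine ⟨?_, ?_⟩
      · have := hstrict (left_mem_Icc.2 T.coe_nonneg) (Ioo_subset_Icc_self ht) ht.1
        rwa [h0] at this
      · have := hstrict (Ioo_subset_Icc_self ht) (right_mem_Icc.2 T.coe_nonneg) ht.2
        rwa [hT] at this
    · intro u hu
      have hcont : ContinuousOn (fun t : ℝ ↦ confClock x₀ W f (toC ⁻¹' Uc) t.toNNReal ω) (Icc (0 : ℝ) T) :=
        ((hW.continuous_confClock hD hf hU hUD hx₀' ω).comp continuous_real_toNNReal).continuousOn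
      have hivt := intermediate_value_Icc T.coe_nonneg hcont
      rw [h0, hT] at hivt
      obtain ⟨t, ht, htu⟩ := hivt ⟨hu.1.le, hu.2.le⟩
      simp only at htu
      refine ⟨t, ⟨lt_of_le_of_ne ht.1 ?_, lt_of_le_of_ne ht.2 ?_⟩, htu⟩
      · rintro rfl; rw [h0] at htu; exact absurd htu (ne_of_lt hu.1)
      · rintro rfl; rw [hT] at htu; exact absurd htu (ne_of_gt hu.2)

/-- **`[Ỹ|[0, σ_t]] = [f ∘ X|[0, t]]`** for `t ≤ ρ`: the time-changed image path up to clock time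
`σ_t` and the image of the original path up to time `t` are two monotone traversals of the same
arc. [cite: Lawler2005ConformallyInvariant, §5.1] -/
theorem curveClass_pathSeg_tcPos_eq (hW : IsBrownianVec W P) (hD : IsOpen D) (hf : DifferentiableOn ℂ f D)
    (hf' : ∀ z ∈ D, deriv f z ≠ 0) (hUc : IsOpen Uc) (hUcb : Bornology.IsBounded Uc)
    (hUcD : closure Uc ⊆ D) (hx₀ : toC x₀ ∈ Uc) {ω : Ω} {T : ℝ≥0} (hρ : hitTime x₀ W (toC ⁻¹' Uc)ᶜ ω = T)
    {t : ℝ≥0} (ht : t ≤ T) :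
    CurveClass.mk (Curve.mk (pathSeg (ContinuousMap.mkD (fun u ↦ tcPos x₀ W f (toC ⁻¹' Uc) u ω) 0)
        (confClock x₀ W f (toC ⁻¹' Uc) t ω).toNNReal)) =
      CurveClass.mk ((Curve.mk (pathSeg (ContinuousMap.mkD (fun t ↦ toC (x₀ + W t ω)) 0) t)).imageOn f D) := by
  have hU : IsOpen (toC ⁻¹' Uc) := hUc.preimage continuous_toC
  have hUD := closure_preimage_subset_preimage (Uc := Uc) hUcD
  have hUC := (isBounded_preimage_toC hUcb).isCompact_closure
  have hx₀' : x₀ ∈ toC ⁻¹' Uc := hx₀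
  have hρ' : hitTime x₀ W (toC ⁻¹' Uc)ᶜ ω ≠ ⊤ := by rw [hρ]; exact WithTop.coe_ne_top
  obtain ⟨m, hm0, hm⟩ := exists_lower_bound hD hf hf' hUcb hUcD
  have hcY := hW.continuous_tcPos_of_ne_top hD hf hf' hU hUC hUD hx₀' hρ'
  have hcX : Continuous fun t ↦ toC (x₀ + W t ω) := continuous_toC.comp (continuous_const.add (hW.continuous_path ω))
  have hσ0 : 0 ≤ confClock x₀ W f (toC ⁻¹' Uc) t ω := by
    have := hW.confClock_mono hD hf hU hUD hx₀' ω (show (0 : ℝ≥0) ≤ t from bot_le); rwa [confClock_zero] at this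
  -- the common arc
  set V : ℝ → ℂ := fun r ↦ f (toC (confPos x₀ W (toC ⁻¹' Uc) r.toNNReal ω)) with hV
  have hfc : ContinuousOn (fun v : Fin 2 → ℝ ↦ f (toC v)) (closure (toC ⁻¹' Uc)) :=
    (hf.continuousOn.comp continuous_toC.continuousOn fun v hv ↦ hv).mono hUD
  have hVc : Continuous V := hfc.comp_continuous ((hW.continuous_confPos ω).comp continuous_real_toNNReal)
    fun r ↦ hW.confPos_mem_closure hU hx₀' _ ω
  -- the two time changes
  set h₁ : ℝ → ℝ := fun x ↦ (clockInvFun x₀ W f (toC ⁻¹' Uc) ω ((confClock x₀ W f (toC ⁻¹' Uc) t ω * x).toNNReal) : ℝ) with hh₁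
  set h₂ : ℝ → ℝ := fun x ↦ (t : ℝ) * x with hh₂
  have hc₁ : Continuous h₁ := NNReal.continuous_coe.comp ((hW.continuous_clockInvFun hD hf hU hUD hx₀' hm0 hm hρ).comp
    (continuous_real_toNNReal.comp (continuous_const.mul continuous_id)))
  have hc₂ : Continuous h₂ := continuous_const.mul continuous_id
  have hmono₁ : Monotone h₁ := fun a b hab ↦ by
    simp only [hh₁]
    exact NNReal.coe_le_coe.2 (by
      have := clockInv_mono (x₀ := x₀) (W := W) (f := f) (U := toC ⁻¹' Uc) ω
        (Real.toNNReal_le_toNNReal (mul_le_mul_of_nonneg_left hab hσ0))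
      simp only [clockInvFun]
      obtain ⟨a', ha'⟩ := WithTop.ne_top_iff_exists.1 (clockInv_ne_top (f := f) hρ
        ((confClock x₀ W f (toC ⁻¹' Uc) t ω * a).toNNReal))
      obtain ⟨b', hb'⟩ := WithTop.ne_top_iff_exists.1 (clockInv_ne_top (f := f) hρ
        ((confClock x₀ W f (toC ⁻¹' Uc) t ω * b).toNNReal))
      rw [← ha', ← hb'] at this ⊢
      rw [untopA_coe, untopA_coe]
      exact WithTop.coe_le_coe.1 this)
  have hmono₂ : Monotone h₂ := fun a b hab ↦ mul_le_mul_of_nonneg_left hab t.coe_nonneg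
  have h₁0 : h₁ 0 = 0 := by
    simp only [hh₁, mul_zero, Real.toNNReal_zero, clockInvFun, clockInv_zero]
    rfl
  have h₂0 : h₂ 0 = 0 := by simp [hh₂]
  have h₁1 : h₁ 1 = t := by
    simp only [hh₁, mul_one, clockInvFun]
    rw [hW.clockInv_confClock hD hf hU hUD hx₀' hm0 hm hρ ht]
  have h₂1 : h₂ 1 = t := by simp [hh₂]
  -- the curves along the time changes
  have hγ₁ : ∀ v : I, (Curve.mk (pathSeg (ContinuousMap.mkD (fun u ↦ tcPos x₀ W f (toC ⁻¹' Uc) u ω) 0)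
      (confClock x₀ W f (toC ⁻¹' Uc) t ω).toNNReal)) v = V (h₁ v) := by
    intro v
    show pathSeg (ContinuousMap.mkD (fun u ↦ tcPos x₀ W f (toC ⁻¹' Uc) u ω) 0)
      (confClock x₀ W f (toC ⁻¹' Uc) t ω).toNNReal v = V (h₁ v)
    rw [pathSeg_apply, ContinuousMap.mkD_apply_of_continuous hcY, tcPos_apply, scaleI_apply,
      ← Real.toNNReal_mul hσ0]
    simp only [hV, hh₁, Real.toNNReal_coe]
  have hseg : ∀ v : I, (scaleI t v : ℝ≥0) ≤ T := fun v ↦ (scaleI_le t v).trans ht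
  have hrange : (Curve.mk (pathSeg (ContinuousMap.mkD (fun t ↦ toC (x₀ + W t ω)) 0) t)).range ⊆ D := by
    rintro _ ⟨v, rfl⟩
    show pathSeg (ContinuousMap.mkD (fun t ↦ toC (x₀ + W t ω)) 0) t v ∈ D
    rw [pathSeg_apply, ContinuousMap.mkD_apply_of_continuous hcX]
    have : x₀ + W (scaleI t v) ω ∈ closure (toC ⁻¹' Uc) := by
      have := hW.confPos_mem_closure hU hx₀' (scaleI t v) ω
      rwa [confPos_of_le (t := T) (by rw [stopT_of_eq_coe hρ, min_self]; exact hseg v)] at this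
    exact hUD this
  have hγ₂ : ∀ v : I, ((Curve.mk (pathSeg (ContinuousMap.mkD (fun t ↦ toC (x₀ + W t ω)) 0) t)).imageOn f D) v =
      V (h₂ v) := by
    intro v
    rw [Curve.imageOn_apply hf.continuousOn hrange]
    show f (pathSeg (ContinuousMap.mkD (fun t ↦ toC (x₀ + W t ω)) 0) t v) = V (h₂ v)
    rw [pathSeg_apply, ContinuousMap.mkD_apply_of_continuous hcX]
    simp only [hV, hh₂]
    rw [Real.toNNReal_mul t.coe_nonneg, Real.toNNReal_coe, ← scaleI_apply,
      confPos_of_le (t := T) (by rw [stopT_of_eq_coe hρ, min_self]; exact hseg v)]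
  have hdist := Curve.reparamDist_eq_zero_of_monotone' t.coe_nonneg hVc.continuousOn hc₁ hc₂ hmono₁ hmono₂
    h₁0 h₂0 h₁1 h₂1 hγ₁ hγ₂
  exact CurveClass.mk_eq_mk_iff_dist_eq_zero.2 hdist

end Original

/-! ### The main identity -/

section Main

variable [IsProbabilityMeasure P] [IsProbabilityMeasure P'] [MeasurableSpace C(ℝ≥0, ℂ)] [BorelSpace C(ℝ≥0, ℂ)]

omit [IsProbabilityMeasure P] [IsProbabilityMeasure P'] in
/-- The functional `(p, u) ↦ 𝟙{p([0,u]) ⊆ V} Ψ([p|[0,u]], u)` is jointly measurable (real time).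
[folklore] -/
theorem measurable_killedFunctional {V : Set ℂ} (hV : IsOpen V) {Ψ : CurveClass ℂ × ℝ → ℝ≥0∞}
    (hΨ : Measurable Ψ) :
    Measurable fun x : C(ℝ≥0, ℂ) × ℝ ↦ (staysIn V).indicator 1 (x.1, x.2.toNNReal) *
      Ψ (CurveClass.mk (Curve.mk (pathSeg x.1 x.2.toNNReal)), x.2) := by
  have h1 : Measurable fun x : C(ℝ≥0, ℂ) × ℝ ↦ (x.1, x.2.toNNReal) :=
    measurable_fst.prodMk (measurable_real_toNNReal.comp measurable_snd)
  have h2 : Measurable fun x : C(ℝ≥0, ℂ) × ℝ≥0 ↦ CurveClass.mk (Curve.mk (pathSeg x.1 x.2)) :=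
    (continuous_curveClass_mk.comp continuous_pathSeg).measurable
  exact ((measurable_one.indicator (measurableSet_staysIn hV)).comp h1).mul
    (hΨ.comp ((h2.comp h1).prodMk measurable_snd))

omit [IsProbabilityMeasure P] [IsProbabilityMeasure P'] [MeasurableSpace C(ℝ≥0, ℂ)] [BorelSpace C(ℝ≥0, ℂ)] in
/-- Restricting an integral over `(0, ∞)` by the indicator of `(-∞, S)` gives the integral over
`(0, S)`. [folklore] -/
theorem lintegral_Ioi_indicator_Iio (S : ℝ) (g : ℝ → ℝ≥0∞) :
    ∫⁻ u in Ioi (0 : ℝ), (Iio S).indicator 1 u * g u = ∫⁻ u in Ioo (0 : ℝ) S, g u := by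
  have e : ∀ u, (Iio S).indicator (1 : ℝ → ℝ≥0∞) u * g u = (Iio S).indicator g u := fun u ↦ by
    by_cases hu : u ∈ Iio S <;> simp [hu]
  simp_rw [e]
  rw [lintegral_indicator measurableSet_Iio, Measure.restrict_restrict measurableSet_Iio, Iio_inter_Ioi]

/-- **Conformal invariance of killed planar Brownian motion, functional form** ([Lawler] Thm. 2.2
with §2.4 / Prop. 5.5): for `f` holomorphic and injective on `D` with `f' ≠ 0`, `U_ℂ` open bounded
with `closure U_ℂ ⊆ D` and `f(U_ℂ)` open, `x₀ ∈ U_ℂ`, and `Ψ ≥ 0` measurable on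
(curve class, time),

  `E[∫₀^{ρ} Ψ([f ∘ X|[0,t]], ∫₀ᵗ|f'(X)|²) |f'(X_t)|² dt] = E'[∫₀^{ρ'} Ψ([B'|[0,u]], u) du]`,

`X = x₀ + W` killed on leaving `U_ℂ`, `B' = f(x₀) + W'` killed on leaving `f(U_ℂ)`; the killing
is the indicator of `staysIn`, paths are read through `ContinuousMap.mkD`, segments through
`pathSeg`, images through `Curve.imageOn`. [cite: Lawler2005ConformallyInvariant, Thm. 2.2] -/
theorem lintegral_killed_conformal_eq (hW : IsBrownianVec W P) (hW' : IsBrownianVec W' P') (hD : IsOpen D)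
    (hf : DifferentiableOn ℂ f D) (hf' : ∀ z ∈ D, deriv f z ≠ 0) (hfi : InjOn f D) (hUc : IsOpen Uc)
    (hUcb : Bornology.IsBounded Uc) (hUcD : closure Uc ⊆ D) (hV : IsOpen (f '' Uc)) (hx₀ : toC x₀ ∈ Uc)
    {Ψ : CurveClass ℂ × ℝ → ℝ≥0∞} (hΨ : Measurable Ψ) :
    ∫⁻ ω, (∫⁻ t in Ioi (0 : ℝ),
        (staysIn Uc).indicator 1 (ContinuousMap.mkD (fun t ↦ toC (x₀ + W t ω)) 0, t.toNNReal) *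
          Ψ (CurveClass.mk ((Curve.mk (pathSeg (ContinuousMap.mkD (fun t ↦ toC (x₀ + W t ω)) 0) t.toNNReal)).imageOn f D),
              ∫ r in (0 : ℝ)..t, ‖deriv f (toC (x₀ + W r.toNNReal ω))‖ ^ 2) *
          ENNReal.ofReal (‖deriv f (toC (x₀ + W t.toNNReal ω))‖ ^ 2)) ∂P =
      ∫⁻ ω', (∫⁻ u in Ioi (0 : ℝ),
        (staysIn (f '' Uc)).indicator 1 (ContinuousMap.mkD (fun u ↦ f (toC x₀) + toC (W' u ω')) 0, u.toNNReal) *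
          Ψ (CurveClass.mk (Curve.mk (pathSeg (ContinuousMap.mkD (fun u ↦ f (toC x₀) + toC (W' u ω')) 0) u.toNNReal)), u))
        ∂P' := by
  classical
  have hU : IsOpen (toC ⁻¹' Uc) := hUc.preimage continuous_toC
  have hUb : Bornology.IsBounded (toC ⁻¹' Uc) := isBounded_preimage_toC hUcb
  have hUD := closure_preimage_subset_preimage (Uc := Uc) hUcD
  have hx₀' : x₀ ∈ toC ⁻¹' Uc := hx₀
  -- the functional on path space
  set F : C(ℝ≥0, ℂ) × ℝ → ℝ≥0∞ := fun x ↦ (staysIn (f '' Uc)).indicator 1 (x.1, x.2.toNNReal) *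
    Ψ (CurveClass.mk (Curve.mk (pathSeg x.1 x.2.toNNReal)), x.2) with hF
  have hFm : Measurable F := measurable_killedFunctional hV hΨ
  set Φ : C(ℝ≥0, ℂ) → ℝ≥0∞ := fun p ↦ ∫⁻ u in Ioi (0 : ℝ), F (p, u) with hΦ
  have hΦm : Measurable Φ := hFm.lintegral_prod_right'
  -- transport along the law identity
  have hlaw := hW.map_mkD_tcEnl_eq hW' hD hf hf' hU hUb hUD hx₀'
  have haem := hW.aemeasurable_mkD_tcEnl hW' hD hf hf' hU hUb hUD hx₀'
  have hBm := measurable_refPath hW' (f (toC x₀))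
  have key : ∫⁻ p, Φ (ContinuousMap.mkD (fun u ↦ tcEnl x₀ W f (toC ⁻¹' Uc) W' u p) 0) ∂(P.prod P') =
      ∫⁻ ω', Φ (⟨fun u ↦ f (toC x₀) + toC (W' u ω'),
        continuous_const.add (continuous_toC.comp (hW'.continuous_path ω'))⟩ : C(ℝ≥0, ℂ)) ∂P' := by
    rw [← lintegral_map' hΦm.aemeasurable haem, hlaw, lintegral_map hΦm hBm]
  -- the right-hand side
  have hR : ∫⁻ ω', Φ (⟨fun u ↦ f (toC x₀) + toC (W' u ω'),
        continuous_const.add (continuous_toC.comp (hW'.continuous_path ω'))⟩ : C(ℝ≥0, ℂ)) ∂P' =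
      ∫⁻ ω', (∫⁻ u in Ioi (0 : ℝ),
        (staysIn (f '' Uc)).indicator 1 (ContinuousMap.mkD (fun u ↦ f (toC x₀) + toC (W' u ω')) 0, u.toNNReal) *
          Ψ (CurveClass.mk (Curve.mk (pathSeg (ContinuousMap.mkD (fun u ↦ f (toC x₀) + toC (W' u ω')) 0) u.toNNReal)), u))
        ∂P' := by
    refine lintegral_congr fun ω' ↦ ?_
    have hc : Continuous fun u ↦ f (toC x₀) + toC (W' u ω') :=
      continuous_const.add (continuous_toC.comp (hW'.continuous_path ω'))
    rw [ContinuousMap.mkD_of_continuous hc]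
  -- the left-hand side, pointwise in `ω` on `{ρ < ∞}`
  set G : Ω → ℝ≥0∞ := fun ω ↦ ∫⁻ u in Ioi (0 : ℝ), (Iio (totClock x₀ W f (toC ⁻¹' Uc) ω)).indicator 1 u *
    Ψ (CurveClass.mk (Curve.mk (pathSeg (ContinuousMap.mkD (fun u ↦ tcPos x₀ W f (toC ⁻¹' Uc) u ω) 0) u.toNNReal)), u)
    with hG
  have hpt : ∀ p : Ω × Ω', hitTime x₀ W (toC ⁻¹' Uc)ᶜ p.1 ≠ ⊤ →
      Φ (ContinuousMap.mkD (fun u ↦ tcEnl x₀ W f (toC ⁻¹' Uc) W' u p) 0) = G p.1 := by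
    intro p hρ
    obtain ⟨T, hT⟩ := WithTop.ne_top_iff_exists.1 hρ
    simp only [hΦ, hF, hG]
    refine setLIntegral_congr_fun measurableSet_Ioi fun u hu ↦ ?_
    have hu0 : 0 ≤ u := le_of_lt hu
    have hiff := hW.mem_staysIn_tcEnl_iff hW' hD hf hf' hfi hUc hUcb hUcD hx₀ hT.symm u.toNNReal
    rw [Real.coe_toNNReal _ hu0] at hiff
    by_cases hlt : u < totClock x₀ W f (toC ⁻¹' Uc) p.1
    · rw [indicator_of_mem (hiff.2 hlt), indicator_of_mem (mem_Iio.2 hlt),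
        hW.pathSeg_tcEnl_eq hW' hD hf hf' hUc hUcb hUcD hx₀ hρ (by rwa [Real.coe_toNNReal _ hu0]),
        Pi.one_apply, Pi.one_apply]
    · rw [indicator_of_notMem (fun h ↦ hlt (hiff.1 h)), indicator_of_notMem (fun h ↦ hlt (mem_Iio.1 h)),
        zero_mul, zero_mul]
  have hL : ∫⁻ p, Φ (ContinuousMap.mkD (fun u ↦ tcEnl x₀ W f (toC ⁻¹' Uc) W' u p) 0) ∂(P.prod P') =
      ∫⁻ ω, G ω ∂P := by
    rw [lintegral_prod (fun p : Ω × Ω' ↦ Φ (ContinuousMap.mkD (fun u ↦ tcEnl x₀ W f (toC ⁻¹' Uc) W' u p) 0))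
      (hΦm.comp_aemeasurable haem)]
    refine lintegral_congr_ae ?_
    filter_upwards [hW.ae_hitTime_ne_top hU hUb hx₀'] with ω hρ
    have : ∀ ω', Φ (ContinuousMap.mkD (fun u ↦ tcEnl x₀ W f (toC ⁻¹' Uc) W' u (ω, ω')) 0) = G ω :=
      fun ω' ↦ hpt (ω, ω') hρ
    simp_rw [this]
    rw [lintegral_const, measure_univ, mul_one]
  -- the time substitution `u = σ_t`, pointwise on `{ρ < ∞}`
  have hsub : ∀ᵐ ω ∂P, G ω = ∫⁻ t in Ioi (0 : ℝ),
      (staysIn Uc).indicator 1 (ContinuousMap.mkD (fun t ↦ toC (x₀ + W t ω)) 0, t.toNNReal) *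
        Ψ (CurveClass.mk ((Curve.mk (pathSeg (ContinuousMap.mkD (fun t ↦ toC (x₀ + W t ω)) 0) t.toNNReal)).imageOn f D),
            ∫ r in (0 : ℝ)..t, ‖deriv f (toC (x₀ + W r.toNNReal ω))‖ ^ 2) *
        ENNReal.ofReal (‖deriv f (toC (x₀ + W t.toNNReal ω))‖ ^ 2) := by
    filter_upwards [hW.ae_hitTime_ne_top hU hUb hx₀'] with ω hρ
    obtain ⟨T, hT⟩ := WithTop.ne_top_iff_exists.1 hρ
    have hρT : hitTime x₀ W (toC ⁻¹' Uc)ᶜ ω = T := hT.symm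
    obtain ⟨hderiv, hinj, himage⟩ := hW.clock_change_of_variables hD hf hf' hUc hUcb hUcD hx₀ hρT
    -- left: integral over `(0, S)` as an image
    simp only [hG]
    rw [lintegral_Ioi_indicator_Iio, ← himage,
      lintegral_image_eq_lintegral_abs_deriv_mul measurableSet_Ioo hderiv hinj]
    -- right: integral over `(0, T)`
    have hright : ∫⁻ t in Ioi (0 : ℝ),
        (staysIn Uc).indicator 1 (ContinuousMap.mkD (fun t ↦ toC (x₀ + W t ω)) 0, t.toNNReal) *
          Ψ (CurveClass.mk ((Curve.mk (pathSeg (ContinuousMap.mkD (fun t ↦ toC (x₀ + W t ω)) 0) t.toNNReal)).imageOn f D),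
              ∫ r in (0 : ℝ)..t, ‖deriv f (toC (x₀ + W r.toNNReal ω))‖ ^ 2) *
          ENNReal.ofReal (‖deriv f (toC (x₀ + W t.toNNReal ω))‖ ^ 2) =
        ∫⁻ t in Ioo (0 : ℝ) T,
          Ψ (CurveClass.mk ((Curve.mk (pathSeg (ContinuousMap.mkD (fun t ↦ toC (x₀ + W t ω)) 0) t.toNNReal)).imageOn f D),
              ∫ r in (0 : ℝ)..t, ‖deriv f (toC (x₀ + W r.toNNReal ω))‖ ^ 2) *
          ENNReal.ofReal (‖deriv f (toC (x₀ + W t.toNNReal ω))‖ ^ 2) := by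
      rw [← lintegral_Ioi_indicator_Iio]
      refine setLIntegral_congr_fun measurableSet_Ioi fun t ht ↦ ?_
      have ht0 : 0 ≤ t := le_of_lt ht
      have hiff := hW.mem_staysIn_path_iff (x₀ := x₀) hUc ω t.toNNReal
      rw [hρT] at hiff
      have hiff' : (ContinuousMap.mkD (fun t ↦ toC (x₀ + W t ω)) 0, t.toNNReal) ∈ staysIn Uc ↔ t < T := by
        rw [hiff, WithTop.coe_lt_coe, ← NNReal.coe_lt_coe, Real.coe_toNNReal _ ht0]
      by_cases hlt : t < T
      · rw [indicator_of_mem (hiff'.2 hlt), indicator_of_mem (mem_Iio.2 hlt), mul_assoc, Pi.one_apply,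
          Pi.one_apply]
      · rw [indicator_of_notMem (fun h ↦ hlt (hiff'.1 h)), indicator_of_notMem (fun h ↦ hlt (mem_Iio.1 h)),
          zero_mul, zero_mul, zero_mul]
    rw [hright]
    refine setLIntegral_congr_fun measurableSet_Ioo fun t ht ↦ ?_
    have ht0 : 0 ≤ t := ht.1.le
    have htT : t.toNNReal ≤ T := Real.toNNReal_le_iff_le_coe.2 ht.2.le
    -- the Jacobian
    rw [clockIntegrand_eq_of_le (f := f) hρT ht.2.le, abs_of_nonneg (by positivity)]
    -- the clock value and the curve class
    have hclock : confClock x₀ W f (toC ⁻¹' Uc) t.toNNReal ω = ∫ r in (0 : ℝ)..t, ‖deriv f (toC (x₀ + W r.toNNReal ω))‖ ^ 2 := by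
      rw [confClock_toNNReal_eq (f := f) hρT ⟨ht0, ht.2.le⟩]
      refine intervalIntegral.integral_congr fun r hr ↦ ?_
      rw [uIcc_of_le ht0] at hr
      exact clockIntegrand_eq_of_le (f := f) hρT (hr.2.trans ht.2.le)
    have hcls := hW.curveClass_pathSeg_tcPos_eq hD hf hf' hUc hUcb hUcD hx₀ hρT htT
    rw [hcls, hclock, mul_comm]
  calc _ = ∫⁻ ω, G ω ∂P := (lintegral_congr_ae hsub).symm
    _ = _ := by rw [← hL, key, hR]

end Main

end IsBrownianVec

end Literature.Probability.Process

end
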